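import Summits.ValiantsHypothesis.ValiantsHypothesis.Theorems.RigidityForcesSymmetryGrenetFirstOrderRankRigidDesignEval

/-!
# Route RigidityForcesSymmetry — `GrenetFirstOrderRankRigid` (item stmt-ValiantsHypothesis-21029),
line `grenet_gauge`: stub `stub_linearRigid`, step 5 (blocks III / I<, part 2) — the gap design

For the crux line `Cruxes/GrenetFirstOrderRankRigid/Lines/grenet_gauge.lean` (blueprint
`Lines/grenet_gauge-stub_linearRigid-PROOF.md`, §5, types III and I<; interface
`Lines/grenet_gauge-stub_linearRigid-BLOCKS.md`).  Tools for the GAP blocks (a pair of vertices `(U, T)`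
with `|U| < |T|`):

* `gap_column_shape` — in the weight block of a tail entry with `|S| = s₀`, `|T| = t₀`, `s₀ + 1 < t₀`, the
  column weights `[c < s] + [t ≤ c] + [c = q]` of any entry `(S'', T'', (p, q))` leave exactly two shapes:
  TAIL-LIKE `(|S''|, |T''|, q) = (s₀, t₀, s₀)` and HEAD-LIKE `(s₀ + 1, t₀ + 1, t₀)`;
* the GAP DESIGN of two orderings `σ`, `τ` of `Fin n`: active columns `c ≤ s₀` (filled by `σ`) and
  `c ≥ t₀` (filled by `τ`), the gap `s₀ < c < t₀` empty; at its point `eval (W ∅ S) = [S = σ({c < |S|})]`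
  for `|S| ≤ s₀ + 1` (`evalGap_W_empty`), `eval (W T univ) = [T = τ({c < |T|})]` for `|T| ≥ t₀`
  (`evalGap_W_univ`), and `eval per_n = 0` (`evalGap_perPoly`);
* small indicator identities (`ite_fin_eq_eq_ite_val_eq`, `ite_mul_ite_mul_ite`, `weightPair_inl`).

The block identities themselves are in `…GapBlocks`.  No new definitions.  VP ≠ VNP is not moved by
this file (first-order bookkeeping about one matrix family).
-/

noncomputable section

open MvPolynomial Matrix Finset

namespace Summit.ValiantsHypothesis.Theorems.RigidityForcesSymmetry.GrenetGauge

open Literature.Computability.AlgebraicComplexity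

/-! ### The column weights of a gap block leave two shapes -/

section ColumnShape

/-- **Column weights in a gap block.**  If `s₀ + 1 < t₀ ≤ n` (a gap between the low columns `< s₀ + 1`
and the high columns `≥ t₀`) and the column-weight functions agree,
`[c < s] + [t ≤ c] + [c = q] = [c < s₀] + [t₀ ≤ c] + [c = s₀]` for all columns `c < n`, then either
`(s, t, q) = (s₀, t₀, s₀)` (TAIL-LIKE) or `(s, t, q) = (s₀ + 1, t₀ + 1, t₀)` with `t₀ < n` (HEAD-LIKE).
[folklore] -/
theorem gap_column_shape {n s₀ t₀ s t q : ℕ} (hgap : s₀ + 1 < t₀) (ht₀ : t₀ ≤ n)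
    (ht : t ≤ n) (hq : q < n)
    (h : ∀ c, c < n → (if c < s then 1 else 0) + (if t ≤ c then 1 else 0) + (if c = q then 1 else 0)
      = (if c < s₀ then 1 else 0) + (if t₀ ≤ c then 1 else 0) + (if c = s₀ then (1 : ℕ) else 0)) :
    (s = s₀ ∧ t = t₀ ∧ q = s₀) ∨ (s = s₀ + 1 ∧ t = t₀ + 1 ∧ q = t₀ ∧ t₀ < n) := by
  -- the gap column `t₀ - 1`
  have h1 : s ≤ t₀ - 1 ∧ t₀ ≤ t ∧ q ≠ t₀ - 1 := by
    have hc := h (t₀ - 1) (by omega)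
    rw [if_neg (show ¬ (t₀ - 1 < s₀) by omega), if_neg (show ¬ (t₀ ≤ t₀ - 1) by omega),
      if_neg (show ¬ (t₀ - 1 = s₀) by omega)] at hc
    split_ifs at hc <;> omega
  -- the gap column `s₀ + 1`
  have h2 : s ≤ s₀ + 1 ∧ q ≠ s₀ + 1 := by
    have hc := h (s₀ + 1) (by omega)
    rw [if_neg (show ¬ (s₀ + 1 < s₀) by omega), if_neg (show ¬ (t₀ ≤ s₀ + 1) by omega),
      if_neg (show ¬ (s₀ + 1 = s₀) by omega)] at hc
    split_ifs at hc <;> omega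
  -- the column `q`: it is low (`≤ s₀`) or high (`≥ t₀`), and `s ≤ q < t`
  have h3 : (q ≤ s₀ ∨ t₀ ≤ q) ∧ s ≤ q ∧ q < t := by
    have hc := h q hq
    rw [if_pos (rfl : q = q)] at hc
    split_ifs at hc <;> omega
  -- the column `s₀`
  have h4 : (s = s₀ + 1 ∧ q ≠ s₀) ∨ (s ≤ s₀ ∧ q = s₀) := by
    have hc := h s₀ (by omega)
    rw [if_neg (show ¬ (s₀ < s₀) by omega), if_neg (show ¬ (t₀ ≤ s₀) by omega), if_pos (rfl : s₀ = s₀)] at hc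
    split_ifs at hc <;> omega
  rcases h4 with ⟨hs1, hq1⟩ | ⟨hs1, hq1⟩
  · -- head-like
    right
    have hq2 : t₀ ≤ q := by omega
    have h5 : q = t₀ := by
      have hc := h t₀ (by omega)
      rw [if_neg (show ¬ (t₀ < s₀) by omega), if_pos (le_refl t₀), if_neg (show ¬ (t₀ = s₀) by omega)] at hc
      split_ifs at hc <;> omega
    refine ⟨hs1, ?_, h5, by omega⟩
    by_cases h6 : t₀ + 1 < n
    · have hc := h (t₀ + 1) h6
      rw [if_neg (show ¬ (t₀ + 1 < s₀) by omega), if_pos (show t₀ ≤ t₀ + 1 by omega),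
        if_neg (show ¬ (t₀ + 1 = s₀) by omega)] at hc
      split_ifs at hc <;> omega
    · omega
  · -- tail-like
    left
    refine ⟨?_, ?_, hq1⟩
    · by_cases h6 : s₀ = 0
      · omega
      · have hc := h (s₀ - 1) (by omega)
        rw [if_pos (show s₀ - 1 < s₀ by omega), if_neg (show ¬ (t₀ ≤ s₀ - 1) by omega),
          if_neg (show ¬ (s₀ - 1 = s₀) by omega)] at hc
        split_ifs at hc <;> omega
    · by_cases h6 : t₀ < n
      · have hc := h t₀ h6
        rw [if_neg (show ¬ (t₀ < s₀) by omega), if_pos (le_refl t₀), if_neg (show ¬ (t₀ = s₀) by omega)] at hc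
        split_ifs at hc <;> omega
      · omega

/-- Indicator of an equality of columns, as naturals: `[c = w] = [(c : ℕ) = (w : ℕ)]`. [folklore] -/
theorem ite_fin_eq_eq_ite_val_eq {n : ℕ} (c w : Fin n) :
    (if c = w then (1 : ℕ) else 0) = if (c : ℕ) = (w : ℕ) then 1 else 0 := by
  by_cases h : c = w
  · rw [if_pos h, if_pos (congrArg Fin.val h)]
  · rw [if_neg h, if_neg fun h' => h (Fin.ext h')]

end ColumnShape

/-! ### The gap design: two orderings and a gap of inactive columns -/

section GapDesign

variable (k : Type*) [CommRing k] {n : ℕ} (σ τ : Equiv.Perm (Fin n)) (s₀ t₀ : ℕ)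
  (D : Fin n × Fin n → k) (d : Fin n → Fin n) (act : Fin n → Prop) [DecidablePred act]
  (hD : ∀ (p c : Fin n), D (p, c) = if act c ∧ d c = p then 1 else 0)
  (hd : ∀ c : Fin n, d c = if (c : ℕ) ≤ s₀ then σ c else τ c)
  (hact : ∀ c : Fin n, act c ↔ ((c : ℕ) ≤ s₀ ∨ t₀ ≤ (c : ℕ)))

include hD hd hact

/-- **Low part of the gap design.**  On the active low columns `c ≤ s₀` the design is the ordering `σ`,
so for `|S| ≤ s₀ + 1`: `eval (W ∅ S) = [S = σ({c < |S|})]`. [folklore] -/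
theorem evalGap_W_empty (S : Finset (Fin n)) (hS : S.card ≤ s₀ + 1) :
    eval D ((1 - Grenet.adj k n).adjugate ∅ S) =
      if (univ.filter fun c : Fin n => (c : ℕ) < S.card).image σ = S then 1 else 0 := by
  classical
  rw [evalDesign_grenet_W_empty k D d act hD]
  have himg : (univ.filter fun c : Fin n => (c : ℕ) < S.card).image d =
      (univ.filter fun c : Fin n => (c : ℕ) < S.card).image σ :=
    Finset.image_congr fun c hc => by
      rw [hd, if_pos (by have := (Finset.mem_filter.mp (Finset.mem_coe.mp hc)).2; omega)]
  by_cases h : (univ.filter fun c : Fin n => (c : ℕ) < S.card).image σ = S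
  · rw [if_pos h, if_pos]
    refine ⟨fun c hc => (hact c).mpr (Or.inl (by omega)), fun c c' hc hc' hcc => ?_, himg.trans h⟩
    rw [hd, hd, if_pos (by omega), if_pos (by omega)] at hcc
    exact σ.injective hcc
  · rw [if_neg h, if_neg fun h' => h (himg.symm.trans h'.2.2)]

/-- **High part of the gap design.**  On the active high columns `c ≥ t₀ > s₀` the design is the
ordering `τ`, so for `|T| ≥ t₀`: `eval (W T univ) = [T = τ({c < |T|})]`. [folklore] -/
theorem evalGap_W_univ (hst : s₀ < t₀) (T : Finset (Fin n)) (hT : t₀ ≤ T.card) :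
    eval D ((1 - Grenet.adj k n).adjugate T univ) =
      if (univ.filter fun c : Fin n => (c : ℕ) < T.card).image τ = T then 1 else 0 := by
  classical
  have hTn : T.card ≤ n := (Finset.card_le_univ T).trans_eq (Fintype.card_fin n)
  rw [evalDesign_grenet_W_univ k D d act hD]
  have hdτ : ∀ c : Fin n, T.card ≤ (c : ℕ) → d c = τ c := fun c hc => by
    rw [hd, if_neg (by omega)]
  -- `τ c ∉ T` for all `c ≥ |T|` iff `T` is the `|T|`-prefix set of `τ`
  have key : (∀ c : Fin n, T.card ≤ (c : ℕ) → τ c ∉ T) ↔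
      (univ.filter fun c : Fin n => (c : ℕ) < T.card).image τ = T := by
    constructor
    · intro h
      symm
      apply Finset.eq_of_subset_of_card_le
      · intro x hx
        rw [Grenet.mem_prefix_image]
        by_contra hlt
        exact h (τ.symm x) (not_lt.mp hlt) (by rwa [Equiv.apply_symm_apply])
      · rw [Grenet.card_prefix_image τ hTn]
    · intro h c hc hcT
      rw [← h, Grenet.mem_prefix_image, Equiv.symm_apply_apply] at hcT
      omega
  by_cases h : (univ.filter fun c : Fin n => (c : ℕ) < T.card).image τ = T
  · rw [if_pos h, if_pos]
    refine ⟨fun c hc => ⟨(hact c).mpr (Or.inr (by omega)), ?_⟩, fun c c' hc hc' hcc => ?_⟩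
    · rw [hdτ c hc]
      exact key.mpr h c hc
    · rw [hdτ c hc, hdτ c' hc'] at hcc
      exact τ.injective hcc
  · rw [if_neg h, if_neg]
    rintro ⟨h1, -⟩
    exact h (key.mp fun c hc => hdτ c hc ▸ (h1 c hc).2)

omit hd in
/-- The permanent vanishes at the gap design (the column `s₀ + 1 < t₀` is inactive). [folklore] -/
theorem evalGap_perPoly (hgap : s₀ + 1 < t₀) (ht₀ : t₀ ≤ n) : eval D (perPoly (Fin n) k) = 0 :=
  evalDesign_perPoly_eq_zero k D d act hD ⟨s₀ + 1, by omega⟩ fun h => by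
    rcases (hact _).mp h with h' | h' <;> simp only at h' <;> omega

end GapDesign

/-! ### Indicator identities -/

section Indicators

variable {k : Type*} [CommRing k]

/-- Three `0/1` indicators multiply to the indicator of the conjunction. [folklore] -/
theorem ite_mul_ite_mul_ite (P Q R : Prop) [Decidable P] [Decidable Q] [Decidable R] :
    ((if P then (1 : k) else 0) * (if Q then 1 else 0) * (if R then 1 else 0))
      = if P ∧ Q ∧ R then 1 else 0 := by
  by_cases hP : P <;> by_cases hQ : Q <;> by_cases hR : R <;> simp [hP, hQ, hR]

/-- Row weights of a tail entry and of its head partner agree: with `U = S + p` (`p ∉ S`) and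
`T' = T + p'` (`p' ∉ T`), `[j₁ ∈ U] + [j₁ ∉ T'] + [j₁ = p'] = [j₁ ∈ S] + [j₁ ∉ T] + [j₁ = p]`. [folklore] -/
theorem weightPair_inl {n : ℕ} (S T : Finset (Fin n)) (p p' j₁ : Fin n) (hp : p ∉ S) (hp' : p' ∉ T) :
    (if j₁ ∈ insert p S then 1 else 0) + (if j₁ ∈ insert p' T then 0 else 1) + (if j₁ = p' then 1 else 0)
      = (if j₁ ∈ S then 1 else 0) + (if j₁ ∈ T then 0 else 1) + (if j₁ = p then (1 : ℕ) else 0) := by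
  by_cases h1 : j₁ = p
  · subst h1
    by_cases h2 : j₁ = p'
    · subst h2
      simp [hp, hp']
    · have h3 : j₁ ∉ insert p' T ↔ j₁ ∉ T := by simp [Finset.mem_insert, h2]
      by_cases h4 : j₁ ∈ T
      · simp [hp, h2, h4]
      · simp [hp, h2, h4]
  · by_cases h2 : j₁ = p'
    · subst h2
      simp [h1, hp']
    · by_cases h3 : j₁ ∈ S <;> by_cases h4 : j₁ ∈ T <;> simp [h1, h2, h3, h4]

end Indicators

end Summit.ValiantsHypothesis.Theorems.RigidityForcesSymmetry.GrenetGauge
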